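import Literature.NumberTheory.Transcendental.AnalytificationProofs
import Mathlib.Topology.IsLocalHomeomorph
import HarnessLib

/-!
# «Holomorphic in algebraic coordinates»: arbitrary opens, and transport along morphisms

Topic `Literature/NumberTheory/Transcendental`, namespace `Literature.NumberTheory.Transcendental`.
THEOREMS ONLY.

The tree's uniformisation data (`ShimuraVarieties.UnitaryBallUniformisationDatum`,
`ModuliOfAbelianVarieties.SiegelModuliDatum`) record that a map `u : G ⊇ O → X(ℂ)` is
«holomorphic in algebraic coordinates»: for every AFFINE open `U ⊆ X` and `s ∈ Γ(X, U)`, the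
function `s ∘ u` is holomorphic on `O ∩ u⁻¹(U(ℂ))` (Serre's definition of a holomorphic map into
`X^h`, GAGA §2 n°5).  This file records the two formal consequences every consumer needs:

* `differentiableOn_evalOrZero_opens_of_affineOpens` — the same then holds for ALL opens `V ⊆ X`
  (affine opens form a basis; `evalOrZero` is compatible with restriction);
* `differentiableOn_evalOrZero_map_comp` — it is inherited by `AlgPoints.map j ∘ u` for every
  morphism `j : X ⟶ Y` (a regular function on `Y` pulls back to a regular function on `X`);
* `isLocalHomeomorph_restrict_map_comp` — if moreover `j` is an open immersion and `O.restrict u`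
  is a local homeomorphism into `X(ℂ)`, then `O.restrict (AlgPoints.map j ∘ u)` is a local
  homeomorphism into `Y(ℂ)` (`j(ℂ)` is an open embedding, SGA1 XII Prop. 3.1 (xi)).

Consumers: the uniformisation of a PIECE of a coproduct `X = ∐ X_q` read as a uniformisation of
`X` (cell hodgecm-mathlib, `stub_S2imm`).

## References

* [SerreGAGA1956] J.-P. Serre, *GAGA*, Ann. Inst. Fourier 6 (1956), §2 n°5 (définition des
  applications holomorphes dans `X^h`).
* [SGA1] A. Grothendieck, M. Raynaud, *SGA 1*, Exp. XII Prop. 3.1 (xi).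
-/

noncomputable section

open Set Function Filter TopologicalSpace CategoryTheory AlgebraicGeometry Opposite
open scoped Topology

namespace Literature.NumberTheory.Transcendental

open Literature.AlgebraicGeometry.Motives (ComplexPoints AlgPoints SchemeOver)
open Literature.AlgebraicGeometry.Motives.AlgPoints

variable {G : Type*} [NormedAddCommGroup G] [NormedSpace ℂ G]
  {k : Type} [Field k] [Algebra k ℂ] {X Y : SchemeOver k}

/-- Restriction compatibility of the total evaluation: for `W ≤ V` and `P ∈ W(ℂ)`,
`evalOrZero V s P = evalOrZero W (s|_W) P`. [cite: SerreGAGA1956, §2 n°5] -/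
theorem evalOrZero_eq_evalOrZero_map_homOfLE {V W : X.left.Opens} (hWV : W ≤ V)
    (s : X.left.presheaf.obj (op V)) {P : ComplexPoints X} (hP : P.pt ∈ W) :
    evalOrZero V s P = evalOrZero W (X.left.presheaf.map (homOfLE hWV).op s) P := by
  rw [evalOrZero_of_mem _ hP, evalOrZero_of_mem _ (hWV hP), AlgPoints.eval_map_homOfLE hWV s hP]

/-- **Holomorphy in algebraic coordinates extends from affine opens to all opens.**  Let
`u : G → X(ℂ)` be continuous on the open set `O ⊆ G` and such that every regular function on an
AFFINE open of `X`, read through `u`, is holomorphic on the part of `O` above it.  Then the same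
holds for every open `V ⊆ X` and `s ∈ Γ(X, V)`: near a point above `V`, choose an affine open
`W ∋ u(v)` inside `V` and use `s|_W`. [cite: SerreGAGA1956, §2 n°5] -/
theorem differentiableOn_evalOrZero_opens_of_affineOpens {u : G → ComplexPoints X} {O : Set G}
    (hO : IsOpen O) (hcont : ContinuousOn u O)
    (hhol : ∀ (U : X.left.affineOpens) (s : X.left.presheaf.obj (op (↑U : X.left.Opens))),
      DifferentiableOn ℂ (fun z ↦ evalOrZero (↑U : X.left.Opens) s (u z))
        (O ∩ u ⁻¹' {P | P.pt ∈ (↑U : X.left.Opens)}))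
    (V : X.left.Opens) (s : X.left.presheaf.obj (op V)) :
    DifferentiableOn ℂ (fun z ↦ evalOrZero V s (u z)) (O ∩ u ⁻¹' {P | P.pt ∈ V}) := by
  intro v hv
  obtain ⟨hvO, hvV⟩ := hv
  have hvV' : (u v).pt ∈ V := hvV
  obtain ⟨_, ⟨W, hW, rfl⟩, hvW, hWV⟩ :=
    X.left.isBasis_affineOpens.exists_subset_of_mem_open hvV' V.2
  set S : Set G := O ∩ u ⁻¹' {P | P.pt ∈ W} with hS
  have hSo : IsOpen S := hcont.isOpen_inter_preimage hO (isOpen_setOf_pt_mem W)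
  have hvS : v ∈ S := ⟨hvO, hvW⟩
  have hWV' : W ≤ V := hWV
  have heq : (fun z ↦ evalOrZero V s (u z)) =ᶠ[𝓝 v]
      fun z ↦ evalOrZero W (X.left.presheaf.map (homOfLE hWV').op s) (u z) := by
    filter_upwards [hSo.mem_nhds hvS] with z hz
    exact evalOrZero_eq_evalOrZero_map_homOfLE hWV' s hz.2
  have hd : DifferentiableAt ℂ
      (fun z ↦ evalOrZero W (X.left.presheaf.map (homOfLE hWV').op s) (u z)) v :=
    (hhol ⟨W, hW⟩ _).differentiableAt (hSo.mem_nhds hvS)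
  exact (heq.differentiableAt_iff.2 hd).differentiableWithinAt

/-- The total evaluation of a regular function on `Y` at the image of a point under `j : X ⟶ Y` is
the total evaluation of the pulled-back function (both junk values `0` off `U`, `j⁻¹U`).
[cite: SerreGAGA1956, §2 n°5] -/
theorem evalOrZero_map_eq_evalOrZero_app (j : X ⟶ Y) (U : Y.left.Opens)
    (s : Y.left.presheaf.obj (op U)) (P : ComplexPoints X) :
    evalOrZero U s (AlgPoints.map j P) = evalOrZero (j.left ⁻¹ᵁ U) (j.left.app U s) P := by
  by_cases h : (AlgPoints.map j P).pt ∈ U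
  · have h' : P.pt ∈ j.left ⁻¹ᵁ U := h
    rw [evalOrZero_of_mem _ h, evalOrZero_of_mem _ h', AlgPoints.eval_map]
  · have h' : P.pt ∉ j.left ⁻¹ᵁ U := h
    rw [evalOrZero_of_not_mem _ h, evalOrZero_of_not_mem _ h']

/-- **Holomorphy in algebraic coordinates is inherited by `j(ℂ) ∘ u`** for every morphism
`j : X ⟶ Y`: regular functions on affine opens of `Y` pull back to regular functions on (arbitrary)
opens of `X`. [cite: SerreGAGA1956, §2 n°5] -/
theorem differentiableOn_evalOrZero_map_comp {u : G → ComplexPoints X} {O : Set G}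
    (hO : IsOpen O) (hcont : ContinuousOn u O)
    (hhol : ∀ (U : X.left.affineOpens) (s : X.left.presheaf.obj (op (↑U : X.left.Opens))),
      DifferentiableOn ℂ (fun z ↦ evalOrZero (↑U : X.left.Opens) s (u z))
        (O ∩ u ⁻¹' {P | P.pt ∈ (↑U : X.left.Opens)}))
    (j : X ⟶ Y) (U : Y.left.affineOpens) (s : Y.left.presheaf.obj (op (↑U : Y.left.Opens))) :
    DifferentiableOn ℂ (fun z ↦ evalOrZero (↑U : Y.left.Opens) s ((AlgPoints.map j ∘ u) z))
      (O ∩ (AlgPoints.map j ∘ u) ⁻¹' {P | P.pt ∈ (↑U : Y.left.Opens)}) := by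
  have hfun : (fun z ↦ evalOrZero (↑U : Y.left.Opens) s ((AlgPoints.map j ∘ u) z)) =
      fun z ↦ evalOrZero (j.left ⁻¹ᵁ (↑U : Y.left.Opens)) (j.left.app _ s) (u z) := by
    funext z
    exact evalOrZero_map_eq_evalOrZero_app j _ s (u z)
  have hset : O ∩ (AlgPoints.map j ∘ u) ⁻¹' {P : ComplexPoints Y | P.pt ∈ (↑U : Y.left.Opens)} =
      O ∩ u ⁻¹' {P : ComplexPoints X | P.pt ∈ j.left ⁻¹ᵁ (↑U : Y.left.Opens)} := rfl
  rw [hfun, hset]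
  exact differentiableOn_evalOrZero_opens_of_affineOpens hO hcont hhol _ _

omit [NormedSpace ℂ G] in
/-- Continuity of `j(ℂ) ∘ u` on `O`. [cite: SGA1, Exp. XII Prop. 3.1 (xi)] -/
theorem continuousOn_map_comp {u : G → ComplexPoints X} {O : Set G} (hcont : ContinuousOn u O)
    (j : X ⟶ Y) : ContinuousOn (AlgPoints.map j ∘ u) O :=
  (continuous_map j).comp_continuousOn hcont

omit [NormedSpace ℂ G] in
/-- **Local homeomorphisms into `X(ℂ)` composed with an open immersion `j : X ⟶ Y`** are local
homeomorphisms into `Y(ℂ)`: `j(ℂ)` is an open embedding (`AlgPoints.isOpenEmbedding_map_holds`).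
[cite: SGA1, Exp. XII Prop. 3.1 (xi)] -/
theorem isLocalHomeomorph_restrict_map_comp {u : G → ComplexPoints X} {O : Set G}
    (hloc : IsLocalHomeomorph (O.restrict u)) (j : X ⟶ Y) [IsOpenImmersion j.left] :
    IsLocalHomeomorph (O.restrict (AlgPoints.map j ∘ u)) :=
  (isOpenEmbedding_map_holds (L := ℂ) j).isLocalHomeomorph.comp hloc

end Literature.NumberTheory.Transcendental
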